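import Summits.QuantumFields.YangMills.Theorems.UnitScaleTiltProp7HcoWOfGaugedRows
import Summits.QuantumFields.YangMills.Theorems.UnitScaleTiltProp7CurvedJunctionLetters
import Literature.MathematicalPhysics.QuantumFieldTheory.Balaban1983to89.T3Thm1CarrierNative
import Literature.MathematicalPhysics.QuantumFieldTheory.Balaban1983to89.B9AdOrthogonal
import HarnessLib

/-!
# Route `UnitScaleTilt`, crux K1 child «MinimiserStabilityRegPr» (stmt-QuantumFields-19200) — **DOOR-VACUITY CERTIFICATE, FILE A: AT THE FLAT BACKGROUND
# `W = 1` NO `(s, κ, C₁, C₂)` SATISFIES THE ROWS OF ✓`Prop7HcoWOfGaugedRows.hcoW_of_gaugedRowsW` FOR A NON-ZERO LONGITUDINAL `𝔰𝔲(2)`-LINE DIRECTION `A`**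

Cell `ym3-torus`, width seat `ym3-torus-px4` (gen 6).  THEOREMS ONLY (0 `def`, 0 `sorry`).  ★★OWNER ym3-torus-plan g29 RULING №16 (5) («a kernel theorem
exhibiting the gauge-heavy datum … at which `hQW`∕`hSig` are contradictory»), ★ ym-ust-19200-p1 g17 WORD 21 (b) GO.  YM₃ on T³ is a ladder rung (R3), not d = 4,
not Clay; nothing here claims `hcoW`, `hcoS`, E′, EX, the stubs or the crux; `--supports stmt-QuantumFields-19200`, count-neutral.  A certificate of NEGATIVE
knowledge about doors already RETIRED as junction doors by RULING №16 (2); it refutes no displayed row and sits on no closing path.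

THE DATUM (★p1 g17 LOCATE v3 «GAUGE HOLE» §0.3, read at the flat background).  `W := 1`; a direction `μ₀` and a real profile `c` of ONE torus coordinate give the
LONGITUDINAL `𝔰𝔲(2)`-LINE FIELD `A⟨x, μ⟩ := [μ = μ₀]·c(x_{μ₀})·σ₃` (displayed by the hypothesis `hA`; `σ₃` = lit ✓`B9AdOrthogonal.σ₃`).  Every such `A` is CLOSED:
the linearised curvature of `hcoW_of_gaugedRowsW`'s HESS row at `W = 1` is `I·η·(A⟨x,μ⟩ + A⟨x+e_μ,ν⟩ − A⟨x+e_ν,μ⟩ − A⟨x,ν⟩) = 0` plaquette by plaquette, because a step in a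
direction `ν ≠ μ₀` does not move the coordinate `x_{μ₀}` (`Function.update_of_ne`) — so `K(1, A) = 0`, while `M = Σ_b ‖ηA b‖² > 0` as soon as `c ≢ 0` (§2–§3).  With a pure-gauge
profile `c(t) = θ(t) − θ(t+1)` this is the abelian residual gauge mode `U₁ = e^{iηA} = 1^{w}` of the LOCATE; FILE A is profile-generic.

WHAT IS PROVED (ns `…Theorems.Prop7GaugedRowsVacuousAtFlat`).
* §1 letters: `σ₃ ≠ 0`, self-adjointness∕tracelessness of the values of `A` ([C4] of the door's binder), and [C5] `U₁ b = exp(I·(ηA) b)` for `U₁ := expHermField (η•A)`.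
* §2 ★ `hessIntegrand_one_eq_zero` — the HESS integrand of the door VERBATIM at `W = 1` vanishes for every plaquette; `hessSum_one_eq_zero` — hence `K(1, A) = 0`.
* §3 `sum_normSq_pos` — `M > 0` when `c t₀ ≠ 0` for some `t₀`.
* §4 ★★ `rows_false_at_flat` — for `W = 1`, every `e > 0` and every `(s, κ, C₁, C₂)`: HESS `κ·M ≤ K(W,A)` ∧ JOINT-mod-coarse-gauge `(C₁, C₂)` ∧ the window
  `2eC₁L^{−2(K−n)} + 15552s² + 216·regThreshold ≤ κ∕8` (the door's rows [R2], [R3], [W2] VERBATIM, `W` kept as a variable with `hW : W = 1`) ⇒ `False`: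
  [R3] at the recursion family ✓`Prop7CurvedLandauRowA.exists_trueLinIter_family` gives `0 ≤ C₁·L^{−(K−n)}·M`, so `0 ≤ C₁`; [R2] with `K = 0 < M` gives `κ ≤ 0`; [W2] then
  says `216·regThreshold ≤ 0` against ✓`regThreshold_pos`.
* §5 the flat background meets the background clauses of the binder for every `e > 0`: [C1] ✓`one_mem_regFibrePr_one` (re-exported in the door's letters) and [C2]
  `deriv_wilsonAction4_comp_eq_zero_of_apply_zero` — E–L along EVERY curve through `1` (global minimum `wilsonAction4 ≥ 0 = wilsonAction4 1`, ✓`T3Thm1CarrierNative.wilsonAction4_one_eq_zero`,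
  Mathlib `IsLocalMin.deriv_eq_zero`; no differentiability or fibre clause needed).
FILES B∕C (sequel): the print clauses [C6] (1.36), [C7] (1.38) multiplier form, [C8] (1.39) on the `ℤ³` pullback for the profile `c = t·(ψ₀ − ψ₀(·+1))`, `Δ₁²ψ₀` block-constant;
the centre-heavy compensator `u` for [C3] (1.29) and [C9]; and `not_hQW`.

HONEST SCOPE.  Lattice kinematics and real arithmetic over the tree's own letters; nothing of Bałaban is asserted or refuted; the door ✓`hcoW_of_gaugedRowsW` is a TRUE
theorem and stays so — this file only shows its hypothesis' rows fail at flat closed data (the «vacuous-as-door» class of RULING №16 (2), kernel-checked at the rows).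

References: T. Bałaban, CMP 102 (1985) 277–309 [Balaban1985Variational] ((2), (4)–(6) p.278, (19)–(21) p.281, (141)–(143) p.299); CMP 99 (1985) 75–102
[Balaban1985RegularSpaces] ((1.29) p.81, (1.36)–(1.38) p.82, (1.39) p.83); CMP 98 (1985) 17–51 [Balaban1985Averaging] ((8)–(9) p.19).
-/

set_option autoImplicit false
noncomputable section

open scoped BigOperators Matrix.Norms.L2Operator Matrix Topology
open Filter NormedSpace

namespace Summit.QuantumFields.YangMills.Theorems.Prop7GaugedRowsVacuousAtFlat

open Literature.MathematicalPhysics.QuantumFieldTheory.Balaban1983to89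
open Literature.MathematicalPhysics.QuantumFieldTheory.Balaban1983to89.T3ContinuumYM3Torus
open Literature.MathematicalPhysics.QuantumFieldTheory.Balaban1983to89.T3UnitLawDensityEML (ℰp)
open Literature.MathematicalPhysics.QuantumFieldTheory.Balaban1983to89.T3ConstrainedMinimiser (fibre)
open Literature.MathematicalPhysics.QuantumFieldTheory.Balaban1983to89.T3PrintedRegularMinimiser
open Literature.MathematicalPhysics.QuantumFieldTheory.Balaban1983to89.T3RegularMinimiser
open Literature.MathematicalPhysics.QuantumFieldTheory.Balaban1983to89.B9AdOrthogonal (σ₃ pauli pauli_two pauli_isHermitian pauli_trace)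
open T4Continuum BlockAveraging AveragingRT ExpMeanLog BlockAveragingEMLLinearised BlockAveragingEMLLinearisedBackground BlockAveragingEMLProp2
open T3SectALandauChart (emb15 eta eta_pos bgUnits)
open Summit.QuantumFields.YangMills.Theorems.Prop7TPrint (expHerm expHermField expHermField_apply coe_expHerm)
open Summit.QuantumFields.YangMills.Theorems.Prop7CurvedLandauRowA (exists_trueLinIter_family)
open Summit.QuantumFields.YangMills.Theorems.Prop7CurvedJunctionLetters (coe_one_apply)
open Literature.MathematicalPhysics.QuantumFieldTheory.Balaban1983to89.T3Thm1CarrierNative (wilsonAction4_one_eq_zero)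

/-! ## §1 The letters of the datum: `σ₃`, the longitudinal line field `A`, its exponential `U₁` -/

/-- `σ₃` is Hermitian and traceless (lit `pauli_isHermitian`∕`pauli_trace` at index `2`). [folklore] -/
theorem σ₃_isHermitian_and_trace : σ₃.IsHermitian ∧ Matrix.trace σ₃ = 0 :=
  ⟨by simpa using pauli_isHermitian 2, by simpa using pauli_trace 2⟩

/-- `σ₃ ≠ 0` (its `(0,0)` entry is `1`). [folklore] -/
theorem σ₃_ne_zero : σ₃ ≠ 0 := by
  intro h
  have h00 := congrFun (congrFun h 0) 0
  simp [σ₃] at h00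

/-- A real multiple of `σ₃` is Hermitian and traceless. [folklore] -/
theorem real_smul_σ₃_isHermitian_and_trace (r : ℝ) : ((r : ℂ) • σ₃).IsHermitian ∧ Matrix.trace ((r : ℂ) • σ₃) = 0 := by
  refine ⟨?_, ?_⟩
  · have h := σ₃_isHermitian_and_trace.1
    unfold Matrix.IsHermitian at h ⊢
    rw [Matrix.conjTranspose_smul, h, Complex.star_def, Complex.conj_ofReal]
  · rw [Matrix.trace_smul, σ₃_isHermitian_and_trace.2, smul_zero]

variable {F : T3Family} {n K : ℕ}

/-- **[C4] of the door's binder at the datum**: every value of the longitudinal line field `A⟨x, μ⟩ = [μ = μ₀]·c(x_{μ₀})·σ₃` is self-adjoint.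
[cite: Balaban1985Variational, (19) p.281] -/
theorem isSelfAdjoint_of_lineField (μ₀ : Fin (F.P K).d) (c : ZMod ((F.P K).sitesPerDir 0) → ℝ)
    {A : PBond (F.P K) 0 → Matrix (Fin 2) (Fin 2) ℂ} (hA : ∀ b, A b = if b.dir = μ₀ then ((c (b.src μ₀) : ℝ) : ℂ) • σ₃ else 0)
    (b : PBond (F.P K) 0) : IsSelfAdjoint (A b) := by
  rw [hA b]
  split_ifs
  · exact (real_smul_σ₃_isHermitian_and_trace _).1
  · exact IsSelfAdjoint.zero _

/-- The values of `η•A` are Hermitian and traceless. [cite: Balaban1985Variational, (19) p.281] -/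
theorem eta_smul_lineField_isHermitian_and_trace (μ₀ : Fin (F.P K).d) (c : ZMod ((F.P K).sitesPerDir 0) → ℝ)
    {A : PBond (F.P K) 0 → Matrix (Fin 2) (Fin 2) ℂ} (hA : ∀ b, A b = if b.dir = μ₀ then ((c (b.src μ₀) : ℝ) : ℂ) • σ₃ else 0)
    (b : PBond (F.P K) 0) : ((eta F n K • A) b).IsHermitian ∧ Matrix.trace ((eta F n K • A) b) = 0 := by
  rw [Pi.smul_apply, hA b]
  split_ifs
  · rw [← Complex.coe_smul, smul_smul, ← Complex.ofReal_mul]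
    exact real_smul_σ₃_isHermitian_and_trace _
  · rw [smul_zero]
    exact ⟨Matrix.isHermitian_zero, Matrix.trace_zero _ _⟩

/-- **[C5] of the door's binder at the datum**: with `U₁ := expHermField (η•A)` (✓`Prop7TPrint.expHermField`), `U₁(b) = exp(I·(η·A(b)))` bondwise.
[cite: Balaban1985Variational, (19) p.281, (112) p.294] -/
theorem coe_expHermField_eta_smul_lineField (μ₀ : Fin (F.P K).d) (c : ZMod ((F.P K).sitesPerDir 0) → ℝ)
    {A : PBond (F.P K) 0 → Matrix (Fin 2) (Fin 2) ℂ} (hA : ∀ b, A b = if b.dir = μ₀ then ((c (b.src μ₀) : ℝ) : ℂ) • σ₃ else 0)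
    (b : PBond (F.P K) 0) :
    ((expHermField (eta F n K • A) b : Matrix.specialUnitaryGroup (Fin 2) ℂ) : Matrix (Fin 2) (Fin 2) ℂ) = exp (Complex.I • ((eta F n K) • A b)) := by
  rw [expHermField_apply, coe_expHerm (eta_smul_lineField_isHermitian_and_trace μ₀ c hA b)]
  rfl

/-! ## §2 `K(1, A) = 0`: the HESS integrand of the door vanishes at `W = 1` for a longitudinal line field -/

/-- A step in a direction `ν ≠ μ₀` does not move the coordinate `μ₀`. [folklore] -/
theorem shift_apply_of_ne {P : Params} {j : ℕ} (x : Site P j) {ν μ₀ : Fin P.d} (h : ν ≠ μ₀) : (x.shift ν) μ₀ = x μ₀ := by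
  unfold Site.shift
  exact Function.update_of_ne (Ne.symm h) _ _

/-- The plaquette variables of the trivial configuration are `1`. [cite: Balaban1985Averaging, (9) p.19] -/
theorem plaqHol_one_eq (p : Plaq (F.P K) 0) : GaugeField.plaqHol (1 : GaugeField (F.P K) 0 (Matrix.specialUnitaryGroup (Fin 2) ℂ)) p = 1 := by
  show (1 : Matrix.specialUnitaryGroup (Fin 2) ℂ) * 1 * 1⁻¹ * 1⁻¹ = 1
  simp

/-- ★ **THE LINEARISED CURVATURE OF A LONGITUDINAL LINE FIELD VANISHES**: for `A⟨x, μ⟩ = [μ = μ₀]·c(x_{μ₀})·σ₃` and every plaquette `p = (x; μ < ν)`,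
`A⟨x,μ⟩ + A⟨x+e_μ,ν⟩ − A⟨x+e_ν,μ⟩ − A⟨x,ν⟩ = 0` — if `μ = μ₀` the two `μ₀`-bonds carry the same value (`(x+e_ν)_{μ₀} = x_{μ₀}`, `ν ≠ μ₀`) and the `ν`-bonds carry `0`;
if `ν = μ₀` symmetrically; otherwise all four vanish. [cite: Balaban1985Variational, (143) p.299 (bookkeeping: the linearised plaquette variable)] -/
theorem lineField_curl_eq_zero (μ₀ : Fin (F.P K).d) (c : ZMod ((F.P K).sitesPerDir 0) → ℝ)
    {A : PBond (F.P K) 0 → Matrix (Fin 2) (Fin 2) ℂ} (hA : ∀ b, A b = if b.dir = μ₀ then ((c (b.src μ₀) : ℝ) : ℂ) • σ₃ else 0)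
    (p : Plaq (F.P K) 0) :
    A ⟨p.src, p.μ⟩ + A ⟨p.src.shift p.μ, p.ν⟩ - A ⟨p.src.shift p.ν, p.μ⟩ - A ⟨p.src, p.ν⟩ = 0 := by
  have hne : p.μ ≠ p.ν := ne_of_lt p.hμν
  rw [hA, hA, hA, hA]
  dsimp only
  by_cases hμ : p.μ = μ₀
  · have hν : p.ν ≠ μ₀ := fun h => hne (hμ.trans h.symm)
    rw [if_pos hμ, if_neg hν, if_pos hμ, if_neg hν, shift_apply_of_ne _ hν]
    abel
  · by_cases hν : p.ν = μ₀
    · have hμ' : p.μ ≠ μ₀ := hμ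
      rw [if_neg hμ', if_pos hν, if_neg hμ', if_pos hν, shift_apply_of_ne _ hμ']
      abel
    · rw [if_neg hμ, if_neg hν, if_neg hμ, if_neg hν]
      abel

/-- ★ **THE HESS INTEGRAND OF THE DOOR AT `W = 1` VANISHES** (the integrand of ✓`hcoW_of_gaugedRowsW`'s row `κ·M ≤ K(W,A)` VERBATIM, `W` a variable with
`hW : W = 1`): all conjugating bond∕plaquette variables are `1`, and the linearised curvature of `I·η·A` is `I·η·(curl A) = 0`. [cite: Balaban1985Variational, (143) p.299] -/
theorem hessIntegrand_eq_zero_of_eq_one (μ₀ : Fin (F.P K).d) (c : ZMod ((F.P K).sitesPerDir 0) → ℝ)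
    {A : PBond (F.P K) 0 → Matrix (Fin 2) (Fin 2) ℂ} (hA : ∀ b, A b = if b.dir = μ₀ then ((c (b.src μ₀) : ℝ) : ℂ) • σ₃ else 0)
    {W : GaugeField (F.P K) 0 (Matrix.specialUnitaryGroup (Fin 2) ℂ)} (hW : W = 1) (p : Plaq (F.P K) 0) :
    ((Complex.I • (eta F n K • A) ⟨p.src, p.μ⟩) + ((W ⟨p.src, p.μ⟩ : Matrix (Fin 2) (Fin 2) ℂ) * (Complex.I • (eta F n K • A) ⟨p.src.shift p.μ, p.ν⟩) * star (W ⟨p.src, p.μ⟩ : Matrix (Fin 2) (Fin 2) ℂ))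
            - (((W ⟨p.src, p.μ⟩ * W ⟨p.src.shift p.μ, p.ν⟩ * (W ⟨p.src.shift p.ν, p.μ⟩)⁻¹ : Matrix.specialUnitaryGroup (Fin 2) ℂ) : Matrix (Fin 2) (Fin 2) ℂ) * (Complex.I • (eta F n K • A) ⟨p.src.shift p.ν, p.μ⟩) * star ((W ⟨p.src, p.μ⟩ * W ⟨p.src.shift p.μ, p.ν⟩ * (W ⟨p.src.shift p.ν, p.μ⟩)⁻¹ : Matrix.specialUnitaryGroup (Fin 2) ℂ) : Matrix (Fin 2) (Fin 2) ℂ))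
            - (((GaugeField.plaqHol W p : Matrix.specialUnitaryGroup (Fin 2) ℂ) : Matrix (Fin 2) (Fin 2) ℂ) * (Complex.I • (eta F n K • A) ⟨p.src, p.ν⟩) * star ((GaugeField.plaqHol W p : Matrix.specialUnitaryGroup (Fin 2) ℂ) : Matrix (Fin 2) (Fin 2) ℂ))) = 0 := by
  subst hW
  have h1 : ∀ b, (((1 : GaugeField (F.P K) 0 (Matrix.specialUnitaryGroup (Fin 2) ℂ)) b : Matrix.specialUnitaryGroup (Fin 2) ℂ) :
      Matrix (Fin 2) (Fin 2) ℂ) = 1 := coe_one_apply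
  have h3 : (((1 : GaugeField (F.P K) 0 (Matrix.specialUnitaryGroup (Fin 2) ℂ)) ⟨p.src, p.μ⟩
            * (1 : GaugeField (F.P K) 0 (Matrix.specialUnitaryGroup (Fin 2) ℂ)) ⟨p.src.shift p.μ, p.ν⟩
            * ((1 : GaugeField (F.P K) 0 (Matrix.specialUnitaryGroup (Fin 2) ℂ)) ⟨p.src.shift p.ν, p.μ⟩)⁻¹ : Matrix.specialUnitaryGroup (Fin 2) ℂ) :
              Matrix (Fin 2) (Fin 2) ℂ) = 1 := by
    show (((1 : Matrix.specialUnitaryGroup (Fin 2) ℂ) * 1 * 1⁻¹ : Matrix.specialUnitaryGroup (Fin 2) ℂ) : Matrix (Fin 2) (Fin 2) ℂ) = 1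
    simp
  have h4 : ((GaugeField.plaqHol (1 : GaugeField (F.P K) 0 (Matrix.specialUnitaryGroup (Fin 2) ℂ)) p : Matrix.specialUnitaryGroup (Fin 2) ℂ) :
      Matrix (Fin 2) (Fin 2) ℂ) = 1 := by
    rw [plaqHol_one_eq]; rfl
  rw [h1, h3, h4, star_one, one_mul, mul_one, one_mul, mul_one, one_mul, mul_one]
  simp only [Pi.smul_apply, ← smul_add, ← smul_sub]
  rw [lineField_curl_eq_zero μ₀ c hA p, smul_zero, smul_zero]

/-- Hence **`K(1, A) = 0`**: the right-hand side of the door's HESS row vanishes at `W = 1`. [cite: Balaban1985Variational, (143) p.299] -/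
theorem hessSum_eq_zero_of_eq_one (μ₀ : Fin (F.P K).d) (c : ZMod ((F.P K).sitesPerDir 0) → ℝ)
    {A : PBond (F.P K) 0 → Matrix (Fin 2) (Fin 2) ℂ} (hA : ∀ b, A b = if b.dir = μ₀ then ((c (b.src μ₀) : ℝ) : ℂ) • σ₃ else 0)
    {W : GaugeField (F.P K) 0 (Matrix.specialUnitaryGroup (Fin 2) ℂ)} (hW : W = 1) :
    ∑ p : Plaq (F.P K) 0, ‖((Complex.I • (eta F n K • A) ⟨p.src, p.μ⟩) + ((W ⟨p.src, p.μ⟩ : Matrix (Fin 2) (Fin 2) ℂ) * (Complex.I • (eta F n K • A) ⟨p.src.shift p.μ, p.ν⟩) * star (W ⟨p.src, p.μ⟩ : Matrix (Fin 2) (Fin 2) ℂ))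
            - (((W ⟨p.src, p.μ⟩ * W ⟨p.src.shift p.μ, p.ν⟩ * (W ⟨p.src.shift p.ν, p.μ⟩)⁻¹ : Matrix.specialUnitaryGroup (Fin 2) ℂ) : Matrix (Fin 2) (Fin 2) ℂ) * (Complex.I • (eta F n K • A) ⟨p.src.shift p.ν, p.μ⟩) * star ((W ⟨p.src, p.μ⟩ * W ⟨p.src.shift p.μ, p.ν⟩ * (W ⟨p.src.shift p.ν, p.μ⟩)⁻¹ : Matrix.specialUnitaryGroup (Fin 2) ℂ) : Matrix (Fin 2) (Fin 2) ℂ))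
            - (((GaugeField.plaqHol W p : Matrix.specialUnitaryGroup (Fin 2) ℂ) : Matrix (Fin 2) (Fin 2) ℂ) * (Complex.I • (eta F n K • A) ⟨p.src, p.ν⟩) * star ((GaugeField.plaqHol W p : Matrix.specialUnitaryGroup (Fin 2) ℂ) : Matrix (Fin 2) (Fin 2) ℂ)))‖ ^ 2 = 0 :=
  Finset.sum_eq_zero fun p _ => by rw [hessIntegrand_eq_zero_of_eq_one μ₀ c hA hW p, norm_zero, zero_pow two_ne_zero]

/-! ## §3 `M > 0` for a non-zero profile -/

/-- **`M = Σ_b ‖ηA b‖² > 0`** as soon as the profile does not vanish identically: the bond `⟨x, μ₀⟩` with `x_{μ₀} = t₀`, `c t₀ ≠ 0`, carries `η·c(t₀)·σ₃ ≠ 0`.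
[cite: Balaban1985Variational, (141) p.299 (bookkeeping: the quadratic size of the perturbation)] -/
theorem sum_normSq_pos (μ₀ : Fin (F.P K).d) (c : ZMod ((F.P K).sitesPerDir 0) → ℝ) (hc : ∃ t, c t ≠ 0)
    {A : PBond (F.P K) 0 → Matrix (Fin 2) (Fin 2) ℂ} (hA : ∀ b, A b = if b.dir = μ₀ then ((c (b.src μ₀) : ℝ) : ℂ) • σ₃ else 0) :
    0 < ∑ b : PBond (F.P K) 0, ‖(eta F n K • A) b‖ ^ 2 := by
  obtain ⟨t, ht⟩ := hc
  let x : Site (F.P K) 0 := fun i => if i = μ₀ then t else 0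
  have hx : x μ₀ = t := by simp [x]
  have hb : (eta F n K • A) ⟨x, μ₀⟩ ≠ 0 := by
    rw [Pi.smul_apply, hA]
    dsimp only
    rw [if_pos rfl, hx]
    refine smul_ne_zero (eta_pos F n K).ne' (smul_ne_zero ?_ σ₃_ne_zero)
    exact_mod_cast ht
  have hpos : 0 < ‖(eta F n K • A) ⟨x, μ₀⟩‖ ^ 2 := by positivity
  exact lt_of_lt_of_le hpos (Finset.single_le_sum (f := fun b : PBond (F.P K) 0 => ‖(eta F n K • A) b‖ ^ 2) (fun b _ => sq_nonneg _)
    (Finset.mem_univ _))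

/-! ## §4 The rows of the door are contradictory at `W = 1` -/

/-- ★★ **AT THE FLAT BACKGROUND THE ROWS OF ✓`hcoW_of_gaugedRowsW` ARE UNSATISFIABLE FOR A NON-ZERO LONGITUDINAL LINE FIELD.**  Hypotheses = the door's rows
[R2] HESS `κ·M ≤ K(W, A)`, [R3] JOINT modulo coarse gauge `(C₁, C₂)` and [W2] the window `2eC₁L^{−2(K−n)} + 15552s² + 216·regThreshold ≤ κ∕8`, VERBATIM with `W` a
variable and `hW : W = 1` (rows [R1], [W1] are not needed).  PROOF: `K(1, A) = 0` (§2) and `M > 0` (§3) give `κ ≤ 0` from [R2]; [R3] instantiated at the recursion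
family ✓`Prop7CurvedLandauRowA.exists_trueLinIter_family W` bounds a sum of norms by `C₁·L^{−(K−n)}·M + C₂·L^{K−n}·0`, so `0 ≤ C₁`; then [W2] forces
`216·regThreshold F n K e ≤ 0`, against ✓`regThreshold_pos`.  This is LOCATE v3 §0.3's inequality «`K∕M < 1728·e·ℓ⁻²` ⇒ no `κ`» at its extreme point `K = 0`.
[cite: Balaban1985Variational, (141)-(143) p.299, (2) p.278] -/
theorem rows_false_at_flat (μ₀ : Fin (F.P K).d) (c : ZMod ((F.P K).sitesPerDir 0) → ℝ) (hc : ∃ t, c t ≠ 0)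
    {A : PBond (F.P K) 0 → Matrix (Fin 2) (Fin 2) ℂ} (hA : ∀ b, A b = if b.dir = μ₀ then ((c (b.src μ₀) : ℝ) : ℂ) • σ₃ else 0)
    {W : GaugeField (F.P K) 0 (Matrix.specialUnitaryGroup (Fin 2) ℂ)} (hW : W = 1) {e s κ C₁ C₂ : ℝ} (he : 0 < e)
    (hq : κ * ∑ b : PBond (F.P K) 0, ‖(eta F n K • A) b‖ ^ 2 ≤ ∑ p : Plaq (F.P K) 0, ‖((Complex.I • (eta F n K • A) ⟨p.src, p.μ⟩) + ((W ⟨p.src, p.μ⟩ : Matrix (Fin 2) (Fin 2) ℂ) * (Complex.I • (eta F n K • A) ⟨p.src.shift p.μ, p.ν⟩) * star (W ⟨p.src, p.μ⟩ : Matrix (Fin 2) (Fin 2) ℂ))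
            - (((W ⟨p.src, p.μ⟩ * W ⟨p.src.shift p.μ, p.ν⟩ * (W ⟨p.src.shift p.ν, p.μ⟩)⁻¹ : Matrix.specialUnitaryGroup (Fin 2) ℂ) : Matrix (Fin 2) (Fin 2) ℂ) * (Complex.I • (eta F n K • A) ⟨p.src.shift p.ν, p.μ⟩) * star ((W ⟨p.src, p.μ⟩ * W ⟨p.src.shift p.μ, p.ν⟩ * (W ⟨p.src.shift p.ν, p.μ⟩)⁻¹ : Matrix.specialUnitaryGroup (Fin 2) ℂ) : Matrix (Fin 2) (Fin 2) ℂ))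
            - (((GaugeField.plaqHol W p : Matrix.specialUnitaryGroup (Fin 2) ℂ) : Matrix (Fin 2) (Fin 2) ℂ) * (Complex.I • (eta F n K • A) ⟨p.src, p.ν⟩) * star ((GaugeField.plaqHol W p : Matrix.specialUnitaryGroup (Fin 2) ℂ) : Matrix (Fin 2) (Fin 2) ℂ)))‖ ^ 2)
    (hJ : ∀ (Q : (k : ℕ) → (PBond (F.P K) 0 → Matrix (Fin 2) (Fin 2) ℂ) → PBond (F.P K) k → Matrix (Fin 2) (Fin 2) ℂ), (∀ Y, Q 0 Y = Y) →
        (∀ (k : ℕ) (Y : PBond (F.P K) 0 → Matrix (Fin 2) (Fin 2) ℂ) (c : PBond (F.P K) (k + 1)), Q (k + 1) Y c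
          = fderiv ℂ (eml : (Idx (F.P K) → Matrix (Fin 2) (Fin 2) ℂ) → Matrix (Fin 2) (Fin 2) ℂ)
              (fun i => ((loopHol (Averaging.iter (fun i => blockAvg (P := F.P K) (j := i) (expMeanLogSU (n := Fin 2))) k W) c i :
                Matrix.specialUnitaryGroup (Fin 2) ℂ) : Matrix (Fin 2) (Fin 2) ℂ))
              (fun i => covWalkSum (Averaging.iter (fun i => blockAvg (P := F.P K) (j := i) (expMeanLogSU (n := Fin 2))) k W) (Q k Y)
                  (walk (emb c.src) (loopWord (F.P K).L c.dir (off i.1) i.2.1 i.2.2))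
                * ((loopHol (Averaging.iter (fun i => blockAvg (P := F.P K) (j := i) (expMeanLogSU (n := Fin 2))) k W) c i :
                  Matrix.specialUnitaryGroup (Fin 2) ℂ) : Matrix (Fin 2) (Fin 2) ℂ))
              * star ((corr (expMeanLogSU (n := Fin 2)) (Averaging.iter (fun i => blockAvg (P := F.P K) (j := i) (expMeanLogSU (n := Fin 2))) k W) c :
                  Matrix.specialUnitaryGroup (Fin 2) ℂ) : Matrix (Fin 2) (Fin 2) ℂ)
            + ((corr (expMeanLogSU (n := Fin 2)) (Averaging.iter (fun i => blockAvg (P := F.P K) (j := i) (expMeanLogSU (n := Fin 2))) k W) c :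
                  Matrix.specialUnitaryGroup (Fin 2) ℂ) : Matrix (Fin 2) (Fin 2) ℂ)
              * covWalkSum (Averaging.iter (fun i => blockAvg (P := F.P K) (j := i) (expMeanLogSU (n := Fin 2))) k W) (Q k Y)
                  (walk (emb c.src) (List.replicate (F.P K).L (c.dir, true)))
              * star ((corr (expMeanLogSU (n := Fin 2)) (Averaging.iter (fun i => blockAvg (P := F.P K) (j := i) (expMeanLogSU (n := Fin 2))) k W) c :
                  Matrix.specialUnitaryGroup (Fin 2) ℂ) : Matrix (Fin 2) (Fin 2) ℂ)) →
            ∃ μ : Site (F.P K) (K - n) → Matrix (Fin 2) (Fin 2) ℂ, (∀ y, μ y ∈ skewAdjoint (Matrix (Fin 2) (Fin 2) ℂ) ∧ (μ y).trace = 0) ∧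
            ∑ c : PBond (F.P K) (K - n), ‖Q (K - n) (fun b => Complex.I • (eta F n K • A) b) c
                - (μ c.src
                  - ((Averaging.iter (fun i => blockAvg (P := F.P K) (j := i) (expMeanLogSU (n := Fin 2))) (K - n) W c : Matrix.specialUnitaryGroup (Fin 2) ℂ) :
                      Matrix (Fin 2) (Fin 2) ℂ) * μ c.tgt
                    * star ((Averaging.iter (fun i => blockAvg (P := F.P K) (j := i) (expMeanLogSU (n := Fin 2))) (K - n) W c : Matrix.specialUnitaryGroup (Fin 2) ℂ) :
                      Matrix (Fin 2) (Fin 2) ℂ))‖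
              ≤ C₁ * ((F.L : ℝ) ^ (K - n))⁻¹ * ∑ b : PBond (F.P K) 0, ‖(eta F n K • A) b‖ ^ 2
                + C₂ * (F.L : ℝ) ^ (K - n) * ∑ p : Plaq (F.P K) 0, ‖((Complex.I • (eta F n K • A) ⟨p.src, p.μ⟩) + ((W ⟨p.src, p.μ⟩ : Matrix (Fin 2) (Fin 2) ℂ) * (Complex.I • (eta F n K • A) ⟨p.src.shift p.μ, p.ν⟩) * star (W ⟨p.src, p.μ⟩ : Matrix (Fin 2) (Fin 2) ℂ))
            - (((W ⟨p.src, p.μ⟩ * W ⟨p.src.shift p.μ, p.ν⟩ * (W ⟨p.src.shift p.ν, p.μ⟩)⁻¹ : Matrix.specialUnitaryGroup (Fin 2) ℂ) : Matrix (Fin 2) (Fin 2) ℂ) * (Complex.I • (eta F n K • A) ⟨p.src.shift p.ν, p.μ⟩) * star ((W ⟨p.src, p.μ⟩ * W ⟨p.src.shift p.μ, p.ν⟩ * (W ⟨p.src.shift p.ν, p.μ⟩)⁻¹ : Matrix.specialUnitaryGroup (Fin 2) ℂ) : Matrix (Fin 2) (Fin 2) ℂ))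
            - (((GaugeField.plaqHol W p : Matrix.specialUnitaryGroup (Fin 2) ℂ) : Matrix (Fin 2) (Fin 2) ℂ) * (Complex.I • (eta F n K • A) ⟨p.src, p.ν⟩) * star ((GaugeField.plaqHol W p : Matrix.specialUnitaryGroup (Fin 2) ℂ) : Matrix (Fin 2) (Fin 2) ℂ)))‖ ^ 2)
    (hw₂ : 2 * e * C₁ * (((F.L : ℝ) ^ (K - n)) ^ 2)⁻¹ + 15552 * s ^ 2 + 216 * regThreshold F n K e ≤ κ / 8) : False := by
  have hK := hessSum_eq_zero_of_eq_one (n := n) μ₀ c hA hW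
  have hM := sum_normSq_pos (n := n) μ₀ c hc hA
  rw [hK] at hq
  have hκ : κ ≤ 0 := by
    by_contra h
    have := mul_pos (lt_of_not_ge h) hM
    linarith
  obtain ⟨Q, hQ0, hQs⟩ := exists_trueLinIter_family (N := 2) W
  obtain ⟨μ, -, hJμ⟩ := hJ Q hQ0 hQs
  rw [hK, mul_zero, add_zero] at hJμ
  have h0 : 0 ≤ C₁ * ((F.L : ℝ) ^ (K - n))⁻¹ * ∑ b : PBond (F.P K) 0, ‖(eta F n K • A) b‖ ^ 2 :=
    le_trans (Finset.sum_nonneg fun _ _ => norm_nonneg _) hJμ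
  have hL : (0 : ℝ) < (F.L : ℝ) := by have := F.hL.2; exact_mod_cast (by omega : 0 < F.L)
  have hLinv : (0 : ℝ) < ((F.L : ℝ) ^ (K - n))⁻¹ := by positivity
  have hC₁ : 0 ≤ C₁ := by
    by_contra h
    have := mul_neg_of_neg_of_pos (mul_neg_of_neg_of_pos (lt_of_not_ge h) hLinv) hM
    linarith
  have hreg := regThreshold_pos F (n := n) (K := K) he
  have h2 : 0 ≤ 2 * e * C₁ * (((F.L : ℝ) ^ (K - n)) ^ 2)⁻¹ := by positivity
  nlinarith [sq_nonneg s]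

/-! ## §5 The flat background meets the background clauses of the binder -/

/-- **[C2] of the door's binder at `W = 1`**: the Wilson action is Euler–Lagrange-critical at the trivial configuration along EVERY curve `γ` with `γ 0 = 1` — it is a
global minimum there (`wilsonAction4 ≥ 0 = wilsonAction4 1`), so `deriv (𝔄 ∘ γ) 0 = 0` by Fermat (Mathlib `IsLocalMin.deriv_eq_zero`, no differentiability needed); the
fibre and differentiability clauses of the binder are not used. [cite: Balaban1985Variational, (141) p.299] -/
theorem deriv_wilsonAction4_comp_eq_zero_of_apply_zero (γ : ℝ → GaugeField (F.P K) 0 (Matrix.specialUnitaryGroup (Fin 2) ℂ)) (h0 : γ 0 = 1) :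
    deriv (fun t => wilsonAction4 (γ t)) 0 = 0 := by
  apply IsLocalMin.deriv_eq_zero
  refine Filter.Eventually.of_forall fun t => ?_
  show wilsonAction4 (γ 0) ≤ wilsonAction4 (γ t)
  rw [h0, wilsonAction4_one_eq_zero]
  exact wilsonAction4_nonneg _

/-- **[C1] of the door's binder at `W = 1`, `V = 1`**: the trivial configuration lies in print's regular fibre (6)(e)(1) for every `e > 0` (lit
✓`one_mem_regFibrePr_one`, restated in the door's letters `regFibrePr F n K hnK.le e V`). [cite: Balaban1985Variational, (6) p.278] -/
theorem one_mem_regFibrePr (hnK : n ≤ K) {e : ℝ} (he : 0 < e) :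
    (1 : GaugeField (F.P K) 0 (Matrix.specialUnitaryGroup (Fin 2) ℂ)) ∈ regFibrePr F n K hnK e 1 :=
  one_mem_regFibrePr_one F he

/-- **[C9] at `W = 1` reads on the perturbation alone**: `emb15 1 U₁ = U₁` (the competitor `U₁·W` of (15) over the trivial background is `U₁`).
[cite: Balaban1985Variational, (15) p.280] -/
theorem emb15_one_left (U₁ : GaugeField (F.P K) 0 (Matrix.specialUnitaryGroup (Fin 2) ℂ)) :
    emb15 (1 : GaugeField (F.P K) 0 (Matrix.specialUnitaryGroup (Fin 2) ℂ)) U₁ = U₁ := by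
  funext b
  show U₁ b * 1 = U₁ b
  rw [mul_one]

end Summit.QuantumFields.YangMills.Theorems.Prop7GaugedRowsVacuousAtFlat

end
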